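import Summits.RiemannHypothesis.RiemannHypothesis.Theses.ScrewSquaringLaw
import HarnessLib

/-!
# Route ScrewSquaringLaw (L45 «SQUARING LAW») — the assembly item (stmt-RiemannHypothesis-23899)

`Assembly : DyadicLandau → SquaringNodes → SquaringLaw → Summit.RiemannHypothesis` — modus ponens twice with the
constant `K = 0`: the squaring law at the integer nodes (`SquaringLaw`, item 23896, the RH-implied residual) is the
`K = 0` instance of the hypothesis of `SquaringNodes` (item 23895, RH-free), whose conclusion — a floor of the doubling
defect on the continuum — is exactly the hypothesis of `DyadicLandau` (item 23894, RH-free), which concludes RH.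
Pure logic over the route decls; no analysis.  Cell rh-split, lead g9 RULING #373 (b) (director-rh g11 00:04:08Z (1));
filer rh-split-typer-1 g7.  RH is NOT proved by this: the three hypotheses are OPEN items (two RH-free cruxes and the
RH-strength residual); nothing here bears on the truth of RH.
-/

-- D-0017: `Summit.RiemannHypothesis.RiemannHypothesis.…` duplicates the namespace BY DESIGN (single-problem summit).
set_option linter.dupNamespace false

namespace Summit.RiemannHypothesis.RiemannHypothesis.Theorems.ScrewSquaringLaw

/-- **`Assembly` holds** (item stmt-RiemannHypothesis-23899): `DyadicLandau → SquaringNodes → SquaringLaw → RH`.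
From `h₃ : SquaringLaw` build the node floor with constant `K = 0` for `h₂ : SquaringNodes`; its conclusion (a
continuum floor `∃ K', ∀ t ≥ 0, Ψ(2t) ≤ 4Ψ(t) + K'`) is the hypothesis of `h₁ : DyadicLandau`, which gives RH. -/
theorem assembly_proof : Summit.RiemannHypothesis.RiemannHypothesis.Theses.ScrewSquaringLaw.Assembly := by
  intro h₁ h₂ h₃
  exact h₁ (h₂ ⟨0, fun m hm => by simpa only [add_zero] using h₃ m hm⟩)

end Summit.RiemannHypothesis.RiemannHypothesis.Theorems.ScrewSquaringLaw
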